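import Literature.Geometry.Symplectic.SteinDomain
import Literature.Topology.FourManifolds.RegularIntervalBoundary
import HarnessLib

/-!
# Shrinking a Stein domain into its interior: `W ≅ {φ ≤ c}` for `c` close to `max φ`

Topic `Literature/Geometry/Symplectic`; proofs file of the fact seat of
`Literature.Geometry.Symplectic.Gompf1998_thm13_twoHandles` (**E2**, `SteinTwoHandles.lean`:
Eliashberg's theorem on attaching 2-handles to a Stein domain along Legendrian knots with framing
`tb - 1`; Gompf 1998, Thm. 1.3 (b)–(c); Akbulut–Matveyev 1998, Thm. 2 (2) and §3).  Everything
here is **proved**; no named fact is introduced and E2 itself is not touched.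

The tree's `SteinStructure W` (`SteinDomain.lean`) is an *abstract* compact complex surface with
`J`-convex boundary: the integrable almost complex structure `J` and the `J`-convex function `φ`
live on `W` up to `∂W = {φ = max φ}` and no ambient complex surface is given.  The printed proofs
of E2 (Eliashberg 1990, §3; Cieliebak–Eliashberg 2012, Thm. 1.5 with Ch. 8; Gompf 1998, the
paragraph after Thm. 1.3) work instead with a regular sublevel set `W = {φ ≤ c}` of an
exhausting `J`-convex function on an *open* complex surface `V`, so that holomorphic charts,
totally real discs and the standard handle can be placed in `V` across `∂W`.  The first step of
E2's proof for the tree's notion is therefore to **shrink** `W` to a high sublevel set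
`W_c = {φ ≤ c} ⊂ int W`, which then sits inside the open complex surface `int W`; this file
supplies the differential-topological half of that step (Milnor's regular interval theorem, in
the form for compact manifolds with boundary proved in the tree,
`Literature.Topology.FourManifolds.nonempty_diffeomorph_sublevel_of_forall_le_mfderiv_ne_zero`,
`RegularIntervalBoundary.lean`):

* `SteinStructure.φ_le_sSup`, `isInteriorPoint_iff_φ_lt`, `φ_lt_sSup_of_isMCriticalPt` — `φ`
  attains its maximum exactly on `∂W`, and critical points of `φ` are interior points;
* `SteinStructure.exists_lt_sSup_forall_mfderiv_ne_zero` — **there are no critical points of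
  `φ` near the top**: some `c₀ < max φ` bounds the critical values strictly (the critical set is
  closed, `Literature.Topology.FourManifolds.isClosed_criticalSet_of_contMDiff`, hence compact,
  and misses `∂W` by the regularity axiom);
* `SteinStructure.exists_addConst`, `SteinStructure.exists_normalize` — adding a constant to
  `φ` gives a Stein structure with the same `J`; on a nonempty `W` one may normalise to
  `max φ = 1`, the normalisation of Milnor's functions adapted to the boundary used by the
  tree's regular interval theorem;
* `SteinStructure.nonempty_diffeomorph_sublevel` — **`W ≅ {φ ≤ c}`** for every `c < max φ`
  above all critical values, the sublevel set carrying the manifold-with-boundary structure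
  `Literature.Topology.FourManifolds.sublevelAtlas` of `RegularSublevelSet.lean` (boundary
  `{φ = c}`, inclusion a smooth embedding); `…_of_sSup_eq_one` is the normalised form to which
  the tree's theorem applies verbatim, `exists_forall_nonempty_diffeomorph_sublevel` the
  packaged form (one `c₀` for all `c ∈ [c₀, max φ)`);
* `SteinStructure.exists_diffeomorph_image_sublevel_eq` — any two high sublevel sets
  `{φ ≤ a} ⊆ {φ ≤ b}`, `b < max φ`, no critical value in `[a, b]`, are moved onto each other by
  a diffeomorphism of `W` (the ambient regular interval theorem of the tree,
  `Literature.Topology.FourManifolds.exists_diffeomorph_image_sublevel_eq_of_isInteriorPoint`).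

The complex-analytic half of the shrinking step — that `(J|W_c, φ|W_c)` is again a Stein
structure on the manifold with boundary `W_c` — is not in this file.

## References

* J. Milnor, *Morse theory*, Ann. of Math. Studies 51 (1963), Thm. 3.1. [Milnor1963]
* K. Cieliebak, Ya. Eliashberg, *From Stein to Weinstein and Back*, AMS Colloquium Publ. 59
  (2012), Def. 1.1 ff. (Stein domains as regular sublevel sets `{φ ≤ c}` of exhausting
  `J`-convex functions), Thm. 1.5 and Ch. 8. [CieliebakEliashberg2012]
* Ya. Eliashberg, *Topological characterization of Stein manifolds of dimension > 2*, Internat.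
  J. Math. 1 (1990), 29–46, §3. [Eliashberg1990Stein]
* R. E. Gompf, *Handlebody construction of Stein surfaces*, Ann. of Math. 148 (1998), 619–693,
  Thm. 1.3 and the paragraph following it. [Gompf1998]
-/

noncomputable section

open scoped Manifold ContDiff Topology
open Set Function

namespace Literature.Geometry.Symplectic

open Literature.Topology.FourManifolds

namespace SteinStructure

variable {W : Type*} [TopologicalSpace W] [ChartedSpace (EuclideanHalfSpace 4) W]
  [IsManifold (𝓡∂ 4) ∞ W] [CompactSpace W]

/-! ### The maximum of `φ` is attained exactly on the boundary -/

/-- The range of `φ` is compact. [folklore] -/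
theorem isCompact_range_φ (S : SteinStructure W) : IsCompact (range S.φ) :=
  isCompact_range S.φ_smooth.continuous

/-- The range of `φ` is bounded above. [folklore] -/
theorem bddAbove_range_φ (S : SteinStructure W) : BddAbove (range S.φ) :=
  S.isCompact_range_φ.bddAbove

/-- `φ ≤ max φ` everywhere. [folklore] -/
theorem φ_le_sSup (S : SteinStructure W) (x : W) : S.φ x ≤ sSup (range S.φ) :=
  le_csSup S.bddAbove_range_φ (mem_range_self x)

/-- `φ x < max φ` iff `x` is not a boundary point (the boundary is the maximal level set).
[cite: Gompf1998, §1] -/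
theorem φ_lt_sSup_iff_not_isBoundaryPoint (S : SteinStructure W) (x : W) :
    S.φ x < sSup (range S.φ) ↔ ¬ (𝓡∂ 4).IsBoundaryPoint x := by
  rw [S.boundary_eq x, lt_iff_le_and_ne]
  exact ⟨fun h => h.2, fun h => ⟨S.φ_le_sSup x, h⟩⟩

/-- **Interior points are the points below the maximum of `φ`.** [cite: Gompf1998, §1] -/
theorem isInteriorPoint_iff_φ_lt (S : SteinStructure W) (x : W) :
    (𝓡∂ 4).IsInteriorPoint x ↔ S.φ x < sSup (range S.φ) := by
  rw [S.φ_lt_sSup_iff_not_isBoundaryPoint, ModelWithCorners.isInteriorPoint_iff_not_isBoundaryPoint]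

/-- A sublevel set `{φ ≤ c}` with `c < max φ` lies in the interior of `W`. [folklore] -/
theorem isInteriorPoint_of_φ_le (S : SteinStructure W) {c : ℝ} (hc : c < sSup (range S.φ)) {x : W}
    (hx : S.φ x ≤ c) : (𝓡∂ 4).IsInteriorPoint x :=
  (S.isInteriorPoint_iff_φ_lt x).2 (hx.trans_lt hc)

/-- **Critical points of `φ` are interior points**, i.e. have value `< max φ`: on `∂W` the
differential of `φ` does not vanish (regularity axiom of a Stein structure). [cite: Gompf1998, §1] -/
theorem φ_lt_sSup_of_isMCriticalPt (S : SteinStructure W) {x : W}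
    (hx : IsMCriticalPt (𝓡∂ 4) S.φ x) : S.φ x < sSup (range S.φ) :=
  (S.φ_lt_sSup_iff_not_isBoundaryPoint x).2 fun hb => S.regular x hb hx

/-! ### No critical points near the top -/

/-- **The critical values of `φ` stay away from the maximum.**  There is `c₀ < max φ` such that
`dφ ≠ 0` wherever `c₀ ≤ φ`: the critical set of the smooth `φ` is closed
(`Literature.Topology.FourManifolds.isClosed_criticalSet_of_contMDiff`), hence compact, so
`φ` attains a maximum `m` on it, and `m < max φ` because critical points are interior points;
take `c₀ = (m + max φ)/2`.  This is the hypothesis "no critical point in `f⁻¹[c, 1]`" of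
Milnor's regular interval theorem for the slabs below `∂W`. [cite: Milnor1963, Thm. 3.1] -/
theorem exists_lt_sSup_forall_mfderiv_ne_zero (S : SteinStructure W) :
    ∃ c₀ < sSup (range S.φ), ∀ x, c₀ ≤ S.φ x → mfderiv (𝓡∂ 4) 𝓘(ℝ, ℝ) S.φ x ≠ 0 := by
  have hC : IsClosed (criticalSet (𝓡∂ 4) S.φ) :=
    isClosed_criticalSet_of_contMDiff S.φ_smooth (by norm_cast)
  have hCc : IsCompact (criticalSet (𝓡∂ 4) S.φ) := hC.isCompact
  rcases (criticalSet (𝓡∂ 4) S.φ).eq_empty_or_nonempty with hCe | hCne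
  · refine ⟨sSup (range S.φ) - 1, by linarith, fun x _ hx => ?_⟩
    have hmem : x ∈ criticalSet (𝓡∂ 4) S.φ := hx
    rw [hCe] at hmem
    exact hmem
  · obtain ⟨x₁, hx₁, hmax⟩ := hCc.exists_isMaxOn hCne S.φ_smooth.continuous.continuousOn
    have h1 : S.φ x₁ < sSup (range S.φ) := S.φ_lt_sSup_of_isMCriticalPt hx₁
    refine ⟨(S.φ x₁ + sSup (range S.φ)) / 2, by linarith, fun x hx hcrit => ?_⟩
    have h2 : S.φ x ≤ S.φ x₁ := hmax (show x ∈ criticalSet (𝓡∂ 4) S.φ from hcrit)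
    linarith

/-- The same, phrased with Milnor's critical points. [cite: Milnor1963, Thm. 3.1] -/
theorem exists_lt_sSup_forall_not_isMCriticalPt (S : SteinStructure W) :
    ∃ c₀ < sSup (range S.φ), ∀ x, c₀ ≤ S.φ x → ¬ IsMCriticalPt (𝓡∂ 4) S.φ x :=
  S.exists_lt_sSup_forall_mfderiv_ne_zero

/-! ### Adding a constant to `φ`; normalisation `max φ = 1` -/

omit [IsManifold (𝓡∂ 4) ∞ W] [CompactSpace W] in
/-- The differential of `φ + a` is that of `φ`. [folklore] -/
theorem mfderiv_add_const_eq {φ : W → ℝ} (hφ : ContMDiff (𝓡∂ 4) 𝓘(ℝ, ℝ) ∞ φ) (a : ℝ) (x : W) :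
    mfderiv (𝓡∂ 4) 𝓘(ℝ, ℝ) (fun y => φ y + a) x = mfderiv (𝓡∂ 4) 𝓘(ℝ, ℝ) φ x := by
  have h := ((hφ x).mdifferentiableAt (by simp)).hasMFDerivAt.add
    (hasMFDerivAt_const (I := 𝓡∂ 4) (I' := 𝓘(ℝ, ℝ)) a x)
  exact h.mfderiv.trans (add_zero _)

omit [IsManifold (𝓡∂ 4) ∞ W] [CompactSpace W] in
/-- `d^ℂ(φ + a) = d^ℂ φ`. [folklore] -/
theorem dComplex_add_const
    (J : (x : W) → (EuclideanSpace ℝ (Fin 4) →L[ℝ] EuclideanSpace ℝ (Fin 4))) {φ : W → ℝ}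
    (hφ : ContMDiff (𝓡∂ 4) 𝓘(ℝ, ℝ) ∞ φ) (a : ℝ) :
    dComplex J (fun y => φ y + a) = dComplex J φ := by
  funext x
  show ContinuousAlternatingMap.ofSubsingleton ℝ (EuclideanSpace ℝ (Fin 4)) ℝ (0 : Fin 1)
      ((mfderiv (𝓡∂ 4) 𝓘(ℝ, ℝ) (fun y => φ y + a) x).comp (J x)) =
    ContinuousAlternatingMap.ofSubsingleton ℝ (EuclideanSpace ℝ (Fin 4)) ℝ (0 : Fin 1)
      ((mfderiv (𝓡∂ 4) 𝓘(ℝ, ℝ) φ x).comp (J x))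
  rw [mfderiv_add_const_eq hφ a x]
  rfl

omit [TopologicalSpace W] [ChartedSpace (EuclideanHalfSpace 4) W] [IsManifold (𝓡∂ 4) ∞ W]
  [CompactSpace W] in
/-- `max (φ + a) = max φ + a` on a nonempty `W` with `φ` bounded above. [folklore] -/
theorem sSup_range_add_const {φ : W → ℝ} (hne : (range φ).Nonempty) (hbdd : BddAbove (range φ))
    (a : ℝ) : sSup (range fun y => φ y + a) = sSup (range φ) + a := by
  have hr : (range fun y => φ y + a) = (OrderIso.addRight a) '' range φ := by
    ext t
    simp only [mem_range, mem_image, OrderIso.addRight_apply, exists_exists_eq_and]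
  rw [hr, ← (OrderIso.addRight a).map_csSup' hne hbdd, OrderIso.addRight_apply]

/-- **Adding a constant to the `J`-convex function of a Stein structure** gives a Stein structure
with the same `J` (every axiom only involves `dφ`, `-dd^ℂφ` or the maximal level set): there is a
Stein structure `S'` on `W` with `S'.J = S.J` and `S'.φ = φ + a`.
[cite: CieliebakEliashberg2012, Def. 1.1 ff.] -/
theorem exists_addConst (S : SteinStructure W) (a : ℝ) :
    ∃ S' : SteinStructure W, S'.J = S.J ∧ S'.φ = fun y => S.φ y + a := by
  refine ⟨{ J := S.J
            φ := fun y => S.φ y + a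
            J_sq := S.J_sq
            J_smooth := S.J_smooth
            integrable := S.integrable
            φ_smooth := S.φ_smooth.add contMDiff_const
            convex := fun x v hv => ?_
            boundary_eq := fun x => ?_
            regular := fun x hx => ?_ }, rfl, rfl⟩
  · rw [dComplex_add_const S.J S.φ_smooth a]
    exact S.convex x v hv
  · have hne : (range S.φ).Nonempty := ⟨S.φ x, mem_range_self x⟩
    rw [sSup_range_add_const hne S.bddAbove_range_φ a, S.boundary_eq x]
    exact ⟨fun h => by rw [h], fun h => add_right_cancel h⟩
  · rw [mfderiv_add_const_eq S.φ_smooth a x]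
    exact S.regular x hx

/-- **Normalisation `max φ = 1`**: on a nonempty `W`, every Stein structure `S` can be replaced
by one with the same `J` and `φ` shifted by the constant `1 - max φ`, whose `J`-convex function
has maximum `1` — so that it equals `1` exactly on `∂W` and is `< 1` inside, Milnor's
normalisation of functions adapted to the boundary consumed by the tree's regular interval
theorem. [cite: Milnor1963, Thm. 3.1] -/
theorem exists_normalize [Nonempty W] (S : SteinStructure W) :
    ∃ S' : SteinStructure W, S'.J = S.J ∧ (S'.φ = fun y => S.φ y + (1 - sSup (range S.φ))) ∧
      sSup (range S'.φ) = 1 := by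
  obtain ⟨S', hJ, hφ⟩ := S.exists_addConst (1 - sSup (range S.φ))
  refine ⟨S', hJ, hφ, ?_⟩
  rw [hφ, sSup_range_add_const (range_nonempty _) S.bddAbove_range_φ]
  ring

/-! ### The regular interval theorem: `W ≅ {φ ≤ c}` -/

/-- For a normalised Stein structure, `φ = 1` on `∂W`. [folklore] -/
theorem φ_eq_one_of_mem_boundary (S : SteinStructure W) (hM : sSup (range S.φ) = 1) {x : W}
    (hx : x ∈ (𝓡∂ 4).boundary W) : S.φ x = 1 :=
  hM ▸ (S.boundary_eq x).1 hx

/-- For a normalised Stein structure, `φ < 1` in the interior. [folklore] -/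
theorem φ_lt_one_of_mem_interior (S : SteinStructure W) (hM : sSup (range S.φ) = 1) {x : W}
    (hx : x ∈ (𝓡∂ 4).interior W) : S.φ x < 1 :=
  hM ▸ (S.isInteriorPoint_iff_φ_lt x).1 hx

/-- **Shrinking a Stein domain (topological half): `W ≅ {φ ≤ c}`.**  Let `S` be a Stein
structure on the compact Hausdorff `W`, normalised to `max φ = 1`, and let `c < 1` be such that
`dφ ≠ 0` wherever `c ≤ φ` (such `c` exist arbitrarily close to `1`,
`exists_lt_sSup_forall_mfderiv_ne_zero`).  Then `W` is diffeomorphic to the sublevel set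
`W_c = {φ ≤ c}` — a compact smooth 4-manifold with boundary `{φ = c}` contained in the interior
of `W`, with the structure `Literature.Topology.FourManifolds.sublevelAtlas` — by Milnor's
regular interval theorem for compact manifolds with boundary
(`Literature.Topology.FourManifolds.nonempty_diffeomorph_sublevel_of_forall_le_mfderiv_ne_zero`:
push `W` into itself along the flow-out of `∂W`, then move the slab by the flow of the cut-off
gradient-like field).  This is the first step of the proof of Eliashberg's theorem for the
tree's abstract Stein domains: `W_c` sits inside the open complex surface `int W`.
[cite: Milnor1963, Thm. 3.1] [cite: CieliebakEliashberg2012, Def. 1.1 ff.] -/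
theorem nonempty_diffeomorph_sublevel_of_sSup_eq_one [T2Space W] (S : SteinStructure W)
    (hM : sSup (range S.φ) = 1) {c : ℝ} (hc : c < 1)
    (hreg : ∀ x, c ≤ S.φ x → mfderiv (𝓡∂ 4) 𝓘(ℝ, ℝ) S.φ x ≠ 0) :
    letI := (sublevelAtlas (k := 3) S.φ_smooth c
      (fun _ hp => S.isInteriorPoint_of_φ_le (hM.symm ▸ hc) hp)
      (fun p hp => hreg p hp.ge)).chartedSpace
    Nonempty (W ≃ₘ⟮𝓡∂ 4, 𝓡∂ 4⟯ ↥(S.φ ⁻¹' Iic c)) :=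
  nonempty_diffeomorph_sublevel_of_forall_le_mfderiv_ne_zero (k := 3) (by norm_num) S.φ_smooth
    (fun _ hx => S.φ_eq_one_of_mem_boundary hM hx) (fun _ hx => S.φ_lt_one_of_mem_interior hM hx)
    hc hreg _ _

/-- **Shrinking a Stein domain (topological half): `W ≅ {φ ≤ c}`, general form.**  For any
Stein structure `S` on the compact Hausdorff `W` and any `c < max φ` with `dφ ≠ 0` wherever
`c ≤ φ` (such `c` exist arbitrarily close to `max φ`, `exists_lt_sSup_forall_mfderiv_ne_zero`),
`W` is diffeomorphic to the regular sublevel set `{φ ≤ c} ⊂ int W` with its structure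
`Literature.Topology.FourManifolds.sublevelAtlas`.  Reduced to the normalised form by shifting
`φ` (`exists_addConst`): the sublevel sets of `φ` and `φ + a` are the same subsets of `W`, and
the identity between the two induced manifold-with-boundary structures is a diffeomorphism
(maps into a regular domain are smooth when smooth into `W`,
`Literature.Topology.FourManifolds.HalfSliceAtlas.contMDiff_codRestrict`; the inclusion is
smooth, `HalfSliceAtlas.contMDiff_subtype_val`). [cite: Milnor1963, Thm. 3.1]
[cite: CieliebakEliashberg2012, Def. 1.1 ff.] -/
theorem nonempty_diffeomorph_sublevel [T2Space W] (S : SteinStructure W) {c : ℝ}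
    (hc : c < sSup (range S.φ)) (hreg : ∀ x, c ≤ S.φ x → mfderiv (𝓡∂ 4) 𝓘(ℝ, ℝ) S.φ x ≠ 0) :
    letI := (sublevelAtlas (k := 3) S.φ_smooth c (fun _ hp => S.isInteriorPoint_of_φ_le hc hp)
      (fun p hp => hreg p hp.ge)).chartedSpace
    Nonempty (W ≃ₘ⟮𝓡∂ 4, 𝓡∂ 4⟯ ↥(S.φ ⁻¹' Iic c)) := by
  set A := sublevelAtlas (k := 3) S.φ_smooth c (fun _ hp => S.isInteriorPoint_of_φ_le hc hp)
    (fun p hp => hreg p hp.ge) with hA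
  letI := A.chartedSpace
  haveI := A.isManifold
  rcases isEmpty_or_nonempty W with hW | hW
  · -- everything is empty
    exact ⟨{ toEquiv := Equiv.equivOfIsEmpty W _,
             contMDiff_toFun := fun x => isEmptyElim x,
             contMDiff_invFun := fun y => isEmptyElim y }⟩
  -- normalise: `φ' = φ + a`, `max φ' = 1`
  set a : ℝ := 1 - sSup (range S.φ) with ha
  obtain ⟨S', -, hφ', hM'⟩ := S.exists_normalize
  set c' : ℝ := c + a with hc'def
  have hc' : c' < 1 := by rw [hc'def, ha]; linarith
  have hφ'x : ∀ x, S'.φ x = S.φ x + a := fun x => by rw [hφ']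
  have hreg' : ∀ x, c' ≤ S'.φ x → mfderiv (𝓡∂ 4) 𝓘(ℝ, ℝ) S'.φ x ≠ 0 := by
    intro x hx
    rw [hφ', mfderiv_add_const_eq S.φ_smooth a x]
    exact hreg x (by rw [hφ'x] at hx; linarith)
  set A' := sublevelAtlas (k := 3) S'.φ_smooth c'
    (fun _ hp => S'.isInteriorPoint_of_φ_le (hM'.symm ▸ hc') hp) (fun p hp => hreg' p hp.ge) with hA'
  letI := A'.chartedSpace
  haveI := A'.isManifold
  obtain ⟨e⟩ := S'.nonempty_diffeomorph_sublevel_of_sSup_eq_one hM' hc' hreg'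
  -- the two sublevel sets coincide
  have hmem : ∀ x, x ∈ S'.φ ⁻¹' Iic c' ↔ x ∈ S.φ ⁻¹' Iic c := fun x => by
    simp only [mem_preimage, mem_Iic, hφ'x, hc'def, add_le_add_iff_right]
  -- the identity maps between the two structures are smooth
  have hg : ContMDiff (𝓡∂ 4) (𝓡∂ 4) ∞
      ((S.φ ⁻¹' Iic c).codRestrict (Subtype.val : ↥(S'.φ ⁻¹' Iic c') → W)
        fun p => (hmem p.1).1 p.2) :=
    A.contMDiff_codRestrict _ (A'.contMDiff_subtype_val (by norm_num))
  have hg' : ContMDiff (𝓡∂ 4) (𝓡∂ 4) ∞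
      ((S'.φ ⁻¹' Iic c').codRestrict (Subtype.val : ↥(S.φ ⁻¹' Iic c) → W)
        fun p => (hmem p.1).2 p.2) :=
    A'.contMDiff_codRestrict _ (A.contMDiff_subtype_val (by norm_num))
  refine ⟨{ toFun := fun x => ⟨(e x).1, (hmem (e x).1).1 (e x).2⟩,
            invFun := fun q => e.symm ⟨q.1, (hmem q.1).2 q.2⟩,
            left_inv := fun x => ?_,
            right_inv := fun q => ?_,
            contMDiff_toFun := hg.comp e.contMDiff,
            contMDiff_invFun := e.symm.contMDiff.comp hg' }⟩
  · show e.symm ⟨(e x).1, _⟩ = x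
    rw [Subtype.coe_eta, Diffeomorph.symm_apply_apply]
  · apply Subtype.ext
    show (e (e.symm ⟨q.1, _⟩)).1 = q.1
    rw [Diffeomorph.apply_symm_apply]

/-- **Shrinking, packaged**: for a Stein structure on a compact Hausdorff `W` there is
`c₀ < max φ` such that no critical point of `φ` has value `≥ c₀`, so that for every
`c ∈ [c₀, max φ)` the sublevel set `{φ ≤ c}` is a regular sublevel set in the interior of `W`,
and each of them is diffeomorphic to `W`. [cite: Milnor1963, Thm. 3.1] -/
theorem exists_forall_nonempty_diffeomorph_sublevel [T2Space W] (S : SteinStructure W) :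
    ∃ c₀ < sSup (range S.φ), ∃ hreg : ∀ x, c₀ ≤ S.φ x → mfderiv (𝓡∂ 4) 𝓘(ℝ, ℝ) S.φ x ≠ 0,
      ∀ (c : ℝ) (hc₀ : c₀ ≤ c) (hc : c < sSup (range S.φ)),
        letI := (sublevelAtlas (k := 3) S.φ_smooth c
          (fun _ hp => S.isInteriorPoint_of_φ_le hc hp)
          (fun p hp => hreg p (hc₀.trans hp.ge))).chartedSpace
        Nonempty (W ≃ₘ⟮𝓡∂ 4, 𝓡∂ 4⟯ ↥(S.φ ⁻¹' Iic c)) := by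
  obtain ⟨c₀, hc₀, hreg⟩ := S.exists_lt_sSup_forall_mfderiv_ne_zero
  exact ⟨c₀, hc₀, hreg, fun c hc₀c hc =>
    S.nonempty_diffeomorph_sublevel hc fun x hx => hreg x (hc₀c.trans hx)⟩

/-- **All high sublevel sets are ambiently diffeomorphic.**  If `a ≤ b < max φ` and `dφ ≠ 0`
wherever `a ≤ φ ≤ b`, a diffeomorphism of `W` moves `{φ ≤ a}` onto `{φ ≤ b}` and the level
`{φ = a}` onto `{φ = b}` (the ambient regular interval theorem of the tree,
`Literature.Topology.FourManifolds.exists_diffeomorph_image_sublevel_eq_of_isInteriorPoint`,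
the slab consisting of interior points because `b < max φ`). [cite: Milnor1963, Thm. 3.1] -/
theorem exists_diffeomorph_image_sublevel_eq [T2Space W] (S : SteinStructure W) {a b : ℝ}
    (hab : a ≤ b) (hb : b < sSup (range S.φ))
    (hreg : ∀ x, S.φ x ∈ Icc a b → mfderiv (𝓡∂ 4) 𝓘(ℝ, ℝ) S.φ x ≠ 0) :
    ∃ Φ : W ≃ₘ⟮𝓡∂ 4, 𝓡∂ 4⟯ W, Φ '' {x | S.φ x ≤ a} = {x | S.φ x ≤ b} ∧
      Φ '' (S.φ ⁻¹' {a}) = S.φ ⁻¹' {b} := by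
  obtain ⟨-, Φ, -, h1, h2, -, -⟩ := exists_diffeomorph_image_sublevel_eq_of_isInteriorPoint
    (I := 𝓡∂ 4) S.φ_smooth hab hreg fun x hx => S.isInteriorPoint_of_φ_le hb hx.2
  exact ⟨Φ, h1, h2⟩

end SteinStructure

end Literature.Geometry.Symplectic

end
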